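import Summits.AnomalousDissipation.AnomalousDissipation.Theorems.SawtoothPulseCascadeK1LocalisedCascadeSlotExpansionTwoBranch

/-!
# K1loc, line `Spectral` / SeqCone — helper: RE-ADMITTING THE ZONE IN ENERGY (overlapping localisers; no PDE restart)

Helper file of the prover lane on the crux `K1LocalisedCascade` (stmt-AnomalousDissipation-19491), route
`SawtoothPulseCascade`, registered stub `stub_highModeConcentration` (memo v7 §2, "S-C′ energy ledger").

The S-C chain of memo v6 (addendum §B) restarts the scalar equation at every half-slot boundary from the cut datum
`d_s = X_s·w(t_s)` and discards the zone remainder `z_s = (1 − X_s)·w(t_s)`; at the end the discarded pieces re-enter the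
low-mode energy as AMPLITUDES (`√E_low ≤ Q_S + Σ_s ‖z_s‖`, `‖z_s‖ ≤ √η_s`), which forces the first tracked phase to
`i₀ ≥ 8–10`.  The energy ledger (memo v7 §2) tracks instead the symbol energy of the TRUE solution cut by the current
slot's carrier cut-off, `T_s² = Σ μ_s² |𝓕(X̂_s·w(t_s))|²` (`…FamilyStep` already applies to `w` itself), and at the switch
`s → s+1` RE-ADMITS the old zone: with `W = X̂_{s+1}·w(t_{s+1})`, `Θ = X_s` (old total cut-off, values in `[0,1]`),
`W = Θ·W + (1 − Θ)·W` and
  `Σ μ² |𝓕W|² ≤ Σ μ² |𝓕(ΘW)|² + M² ∫ |(1−Θ)W|² + 2·|cross|`,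
where the two localisers `Θ`, `1 − Θ` OVERLAP (on the transition layer of `Θ`).  This file supplies the cross-term bound
for overlapping localisers — the disjoint case is `…SpectralCommutator.norm_tsum_symbol_sq_cross_le` — and the resulting
re-admission inequality:

* `norm_tsum_symbol_sq_cross_le_of_overlap` — for continuous `G, Θ₁` with summable coefficients, continuous `Θ₂` with
  `‖Θ₂‖ ≤ 1`, a real symbol `|m| ≤ M` whose square has modulus `ω₂`:
  `|Σₖ m_k² 𝓕(Θ₁G)(k) conj 𝓕(Θ₂G)(k)| ≤ (Σₙ ω₂ n ‖𝓕Θ₁ n‖)·∫‖G‖² + M²·√(∫‖G‖²)·√(∫‖Θ₁Θ₂G‖²)`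
  (commutator `[m(D)², Θ₁]` plus `⟨m(D)²G, Θ̄₁Θ₂G⟩`, the latter living on the overlap only);
* `tsum_symbol_sq_le_readmit` — the displayed re-admission inequality (the zone piece enters SQUARED:
  `M²∫|(1−Θ)W|² ≤ M²‖W‖_∞²·vol{Θ < 1}`, an ENERGY of the size of the zone measure `η_s`, not `√η_s`);
* `integral_norm_sq_overlap_le` — `∫‖Θ(1−Θ)W‖² ≤ (B/4)²·vol{0 < Θ < 1}` for real `Θ ∈ [0,1]` and `‖W‖ ≤ B` (the
  overlap term is carried by the transition layer of the cut-off only);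
* `sq_add_le_sq_add_of_le` / `ledger_le_add_sum` — the bookkeeping arithmetic: an amplitude step `T ↦ T + a` with
  `0 ≤ T ≤ B` costs at most `2Ba + a²` in energy, and `V (s+1) ≤ V s + ε s` telescopes to
  `V n ≤ V i₀ + Σ_{i₀ ≤ s < n} ε s`.

WHAT THIS IS NOT: no statement about the cascade or the stub itself; line-independent Fourier/bookkeeping tools for the
energy form of the S-C chain (the per-slot analytic inputs are `…FamilyStep`, `…InputSplit`, `…SmoothLeakage.sqrt_tsum_symbol_sq_mul_le`,
`…SpectralCommutator.norm_tsum_symbol_sq_cross_le`, `…ZoneJunk`).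
[cite: Grafakos2014, Prop. 3.1.2 (5) (coefficients of products) and Prop. 3.2.7 (3) (Parseval)] [problem: turb]
-/

-- `Summit.<Summit>.<Problem>`: single-conjunct summit, the duplicate namespace segment is deliberate.
set_option linter.dupNamespace false

noncomputable section

namespace Summit.AnomalousDissipation.AnomalousDissipation.Theorems.SawtoothPulseCascade.K1Slot

open MeasureTheory Set Filter Topology UnitAddTorus Complex
open scoped ComplexConjugate
open Literature.Analysis Literature.Analysis.FunctionSpaces Literature.Analysis.FluidPDE
open Literature.Analysis.FunctionSpaces.Torus
open Summit.AnomalousDissipation.AnomalousDissipation.Theorems.SawtoothPulseCascade.SpectralLeakage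

variable {d : Type*} [Fintype d]

/-! ## §1 The cross term of two OVERLAPPING localisers -/

/-- **Cross-term bound for overlapping localisers.**  Let `G, Θ₁ : T^d → ℂ` be continuous with absolutely summable
coefficients, `Θ₂` continuous with `‖Θ₂‖ ≤ 1`, and `m` a real symbol with `|m| ≤ M` whose square has modulus `ω₂`
(`|m k² − m (k−n)²| ≤ ω₂ n`, `Σₙ ω₂ n ‖𝓕Θ₁ n‖ < ∞`).  Then
`|Σₖ m_k² 𝓕(Θ₁G)(k) conj(𝓕(Θ₂G)(k))| ≤ (Σₙ ω₂ n ‖𝓕Θ₁ n‖)·∫‖G‖² + M²·√(∫‖G‖²)·√(∫‖Θ₁ Θ₂ G‖²)`: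
the pairing splits as `⟨[m(D)², Θ₁]G, Θ₂G⟩ + ⟨Θ₁·m(D)²G, Θ₂G⟩`; the first summand is the commutator
(`sqrt_tsum_sq_commutator_le`), the second equals `⟨m(D)²G, Θ̄₁Θ₂G⟩` (Parseval twice) and is bounded by Cauchy–Schwarz —
it VANISHES for disjoint localisers (`norm_tsum_symbol_sq_cross_le`) and in general lives on the overlap `supp Θ₁Θ₂` only.
[cite: Grafakos2014, Prop. 3.1.2 (5) and Prop. 3.2.7 (3)] -/
theorem norm_tsum_symbol_sq_cross_le_of_overlap {G Θ₁ Θ₂ : UnitAddTorus d → ℂ} (hG : Continuous G)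
    (hGs : Summable fun k => ‖mFourierCoeff G k‖) (hΘ₁ : Continuous Θ₁)
    (hΘ₁s : Summable fun k => ‖mFourierCoeff Θ₁ k‖) (hΘ₂ : Continuous Θ₂) (hΘ₂1 : ∀ x, ‖Θ₂ x‖ ≤ 1)
    {m : (d → ℤ) → ℝ} {M : ℝ} (hmM : ∀ k, |m k| ≤ M) {ω₂ : (d → ℤ) → ℝ} (hω0 : ∀ n, 0 ≤ ω₂ n)
    (hω : ∀ k n, |m k ^ 2 - m (k - n) ^ 2| ≤ ω₂ n) (hωs : Summable fun n => ω₂ n * ‖mFourierCoeff Θ₁ n‖) :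
    ‖∑' k, ((m k ^ 2 : ℝ) : ℂ) * mFourierCoeff (fun x => Θ₁ x * G x) k *
        conj (mFourierCoeff (fun x => Θ₂ x * G x) k)‖ ≤
      (∑' n, ω₂ n * ‖mFourierCoeff Θ₁ n‖) * (∫ x, ‖G x‖ ^ 2) +
        M ^ 2 * Real.sqrt (∫ x, ‖G x‖ ^ 2) * Real.sqrt (∫ x, ‖Θ₁ x * Θ₂ x * G x‖ ^ 2) := by
  classical
  have hM0 : 0 ≤ M := (abs_nonneg _).trans (hmM 0)
  -- the commutator estimate for the symbol `m²`
  have hm2 : ∀ k, |m k ^ 2| ≤ M ^ 2 := fun k => by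
    rw [abs_pow]; exact pow_le_pow_left₀ (abs_nonneg _) (hmM k) 2
  obtain ⟨hRs, hR⟩ := sqrt_tsum_sq_commutator_le (m := fun k => m k ^ 2) hG hGs hΘ₁ hΘ₁s hm2 hω0 hω hωs
  set H : UnitAddTorus d → ℂ := fourierSynth (fun k => ((m k ^ 2 : ℝ) : ℂ) * mFourierCoeff G k) with hH_def
  have hh : Summable fun k => ‖((m k ^ 2 : ℝ) : ℂ) * mFourierCoeff G k‖ :=
    (hGs.mul_left (M ^ 2)).of_nonneg_of_le (fun _ => norm_nonneg _) fun k => by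
      rw [norm_mul, Complex.norm_real, Real.norm_eq_abs]
      exact mul_le_mul_of_nonneg_right (hm2 k) (norm_nonneg _)
  have hH_c : Continuous H := continuous_fourierSynth hh
  have hH_coeff : ∀ k, mFourierCoeff H k = ((m k ^ 2 : ℝ) : ℂ) * mFourierCoeff G k :=
    mFourierCoeff_fourierSynth hh
  -- names for the coefficient families
  set a : (d → ℤ) → ℂ := fun k => mFourierCoeff (fun x => Θ₁ x * G x) k with ha_def
  set b : (d → ℤ) → ℂ := fun k => mFourierCoeff (fun x => Θ₂ x * G x) k with hb_def
  set p : (d → ℤ) → ℂ := fun k => mFourierCoeff (fun x => Θ₁ x * H x) k with hp_def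
  set u : (d → ℤ) → ℂ := fun k => ((m k ^ 2 : ℝ) : ℂ) * a k - p k with hu_def
  -- the overlap function `Θ̄₁ Θ₂ G`
  set L : UnitAddTorus d → ℂ := fun x => conj (Θ₁ x) * Θ₂ x * G x with hL_def
  have hL_c : Continuous L := (hΘ₁.star.mul hΘ₂).mul hG
  have hParsb := hasSum_sq_mFourierCoeff_of_continuous (g := fun x => Θ₂ x * G x) (hΘ₂.mul hG)
  have hParsp := hasSum_sq_mFourierCoeff_of_continuous (g := fun x => Θ₁ x * H x) (hΘ₁.mul hH_c)
  have hParsG := hasSum_sq_mFourierCoeff_of_continuous hG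
  have hParsH := hasSum_sq_mFourierCoeff_of_continuous hH_c
  have hParsL := hasSum_sq_mFourierCoeff_of_continuous hL_c
  -- `Σ p conj(b) = Σ 𝓕H · conj(𝓕L)` (Parseval twice: both equal `∫ conj(Θ₂G)·Θ₁H = ∫ conj(L)·H`, conjugated)
  have hpb_s : Summable fun k => p k * conj (b k) := (norm_tsum_mul_conj_le hParsp.summable hParsb.summable).1
  obtain ⟨hHL_s, hHL⟩ := norm_tsum_mul_conj_le (u := fun k => mFourierCoeff H k) (v := fun k => mFourierCoeff L k)
    hParsH.summable hParsL.summable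
  have hpb_eq : ‖∑' k, p k * conj (b k)‖ = ‖∑' k, mFourierCoeff H k * conj (mFourierCoeff L k)‖ := by
    -- `Σ conj(b) p = ∫ conj(Θ₂G) Θ₁H` and `Σ conj(𝓕L) 𝓕H = ∫ conj(L) H`, with equal integrands
    have h1 := Literature.Analysis.FluidPDE.Torus.hasSum_conj_mFourierCoeff_mul_of_continuous
      (f := fun x => Θ₂ x * G x) (g := fun x => Θ₁ x * H x) (hΘ₂.mul hG) (hΘ₁.mul hH_c)
    have h2 := Literature.Analysis.FluidPDE.Torus.hasSum_conj_mFourierCoeff_mul_of_continuous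
      (f := L) (g := H) hL_c hH_c
    have hint : (∫ x, conj (Θ₂ x * G x) * (Θ₁ x * H x)) = ∫ x, conj (L x) * H x := by
      refine integral_congr_ae (ae_of_all _ fun x => ?_)
      simp only [hL_def, map_mul, Complex.conj_conj]
      ring
    have e1 : ∑' k, p k * conj (b k) = ∑' k, conj (b k) * p k := tsum_congr fun k => mul_comm _ _
    have e2 : ∑' k, mFourierCoeff H k * conj (mFourierCoeff L k) = ∑' k, conj (mFourierCoeff L k) * mFourierCoeff H k :=
      tsum_congr fun k => mul_comm _ _
    rw [e1, e2, h1.tsum_eq, h2.tsum_eq, hint]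
  -- split the sum
  obtain ⟨hub_s, hub⟩ := norm_tsum_mul_conj_le (u := u) (v := b) hRs hParsb.summable
  have hsum_eq : ∑' k, ((m k ^ 2 : ℝ) : ℂ) * a k * conj (b k) = ∑' k, u k * conj (b k) + ∑' k, p k * conj (b k) := by
    rw [← hub_s.tsum_add hpb_s]
    refine tsum_congr fun k => ?_
    rw [hu_def]
    ring
  rw [hsum_eq]
  -- bounds on the four `ℓ²` norms
  have hint0 : 0 ≤ ∫ x, ‖G x‖ ^ 2 := integral_nonneg fun x => by positivity
  have hb_le : Real.sqrt (∑' k, ‖b k‖ ^ 2) ≤ Real.sqrt (∫ x, ‖G x‖ ^ 2) := by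
    rw [hParsb.tsum_eq]
    refine Real.sqrt_le_sqrt ?_
    have := integral_norm_sq_mul_le hG hΘ₂1
    simpa using this
  have hH_le : Real.sqrt (∑' k, ‖mFourierCoeff H k‖ ^ 2) ≤ M ^ 2 * Real.sqrt (∫ x, ‖G x‖ ^ 2) := by
    have hle : ∑' k, ‖mFourierCoeff H k‖ ^ 2 ≤ (M ^ 2) ^ 2 * ∫ x, ‖G x‖ ^ 2 := by
      rw [← hParsG.tsum_eq, ← tsum_mul_left]
      refine Summable.tsum_le_tsum (fun k => ?_) hParsH.summable (hParsG.summable.mul_left _)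
      rw [hH_coeff, norm_mul, mul_pow, Complex.norm_real, Real.norm_eq_abs]
      exact mul_le_mul_of_nonneg_right (pow_le_pow_left₀ (abs_nonneg _) (hm2 k) 2) (sq_nonneg _)
    calc Real.sqrt (∑' k, ‖mFourierCoeff H k‖ ^ 2) ≤ Real.sqrt ((M ^ 2) ^ 2 * ∫ x, ‖G x‖ ^ 2) := Real.sqrt_le_sqrt hle
      _ = M ^ 2 * Real.sqrt (∫ x, ‖G x‖ ^ 2) := by
          rw [Real.sqrt_mul (by positivity), Real.sqrt_sq (by positivity)]
  have hL_eq : (∑' k, ‖mFourierCoeff L k‖ ^ 2) = ∫ x, ‖Θ₁ x * Θ₂ x * G x‖ ^ 2 := by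
    rw [hParsL.tsum_eq]
    refine integral_congr_ae (ae_of_all _ fun x => ?_)
    simp only [hL_def, norm_mul, RCLike.norm_conj]
  have hω_nn : 0 ≤ ∑' n, ω₂ n * ‖mFourierCoeff Θ₁ n‖ := tsum_nonneg fun n => mul_nonneg (hω0 n) (norm_nonneg _)
  -- assemble
  calc ‖∑' k, u k * conj (b k) + ∑' k, p k * conj (b k)‖
      ≤ ‖∑' k, u k * conj (b k)‖ + ‖∑' k, p k * conj (b k)‖ := norm_add_le _ _
    _ ≤ Real.sqrt (∑' k, ‖u k‖ ^ 2) * Real.sqrt (∑' k, ‖b k‖ ^ 2) +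
          Real.sqrt (∑' k, ‖mFourierCoeff H k‖ ^ 2) * Real.sqrt (∑' k, ‖mFourierCoeff L k‖ ^ 2) := by
        rw [hpb_eq]; exact add_le_add hub hHL
    _ ≤ ((∑' n, ω₂ n * ‖mFourierCoeff Θ₁ n‖) * Real.sqrt (∫ x, ‖G x‖ ^ 2)) * Real.sqrt (∫ x, ‖G x‖ ^ 2) +
          (M ^ 2 * Real.sqrt (∫ x, ‖G x‖ ^ 2)) * Real.sqrt (∫ x, ‖Θ₁ x * Θ₂ x * G x‖ ^ 2) := by
        refine add_le_add (mul_le_mul hR hb_le (Real.sqrt_nonneg _) (mul_nonneg hω_nn (Real.sqrt_nonneg _))) ?_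
        rw [← hL_eq]
        exact mul_le_mul_of_nonneg_right hH_le (Real.sqrt_nonneg _)
    _ = (∑' n, ω₂ n * ‖mFourierCoeff Θ₁ n‖) * (∫ x, ‖G x‖ ^ 2) +
          M ^ 2 * Real.sqrt (∫ x, ‖G x‖ ^ 2) * Real.sqrt (∫ x, ‖Θ₁ x * Θ₂ x * G x‖ ^ 2) := by
        rw [mul_assoc (∑' n, ω₂ n * ‖mFourierCoeff Θ₁ n‖), Real.mul_self_sqrt hint0]

/-! ## §2 Re-admitting the zone: the switch inequality in energy -/

/-- Symbol energies are at most `M²` times the `L²` energy: `Σ m²|𝓕Q|² ≤ M² ∫‖Q‖²`. [cite: Grafakos2014, Prop. 3.2.7 (3) (Parseval)] -/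
theorem tsum_symbol_sq_le_sq_mul_integral {Q : UnitAddTorus d → ℂ} (hQ : Continuous Q) {m : (d → ℤ) → ℝ} {M : ℝ}
    (hmM : ∀ k, |m k| ≤ M) :
    (Summable fun k => m k ^ 2 * ‖mFourierCoeff Q k‖ ^ 2) ∧
      ∑' k, m k ^ 2 * ‖mFourierCoeff Q k‖ ^ 2 ≤ M ^ 2 * ∫ x, ‖Q x‖ ^ 2 := by
  have hm2 : ∀ k, m k ^ 2 ≤ M ^ 2 := fun k => by
    rw [← sq_abs]; exact pow_le_pow_left₀ (abs_nonneg _) (hmM k) 2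
  have hP := hasSum_sq_mFourierCoeff_of_continuous hQ
  have hs : Summable fun k => m k ^ 2 * ‖mFourierCoeff Q k‖ ^ 2 :=
    (hP.summable.mul_left (M ^ 2)).of_nonneg_of_le (fun k => by positivity)
      fun k => mul_le_mul_of_nonneg_right (hm2 k) (sq_nonneg _)
  refine ⟨hs, ?_⟩
  rw [← hP.tsum_eq, ← tsum_mul_left]
  exact hs.tsum_le_tsum (fun k => mul_le_mul_of_nonneg_right (hm2 k) (sq_nonneg _)) (hP.summable.mul_left _)

/-- **Re-admission of the zone, in energy.**  Let `W : T^d → ℂ` be continuous with absolutely summable coefficients,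
`Θ` continuous with absolutely summable coefficients and `‖1 − Θ‖ ≤ 1` (e.g. a real cut-off with values in
`[0,1]`), and `m` a real symbol, `|m| ≤ M`, whose square has modulus `ω₂` with `Σ ω₂‖𝓕Θ‖ < ∞`.  Then
`Σ m²|𝓕W|² ≤ Σ m²|𝓕(ΘW)|² + M²∫‖(1−Θ)W‖² + 2·((Σ ω₂‖𝓕Θ‖)∫‖W‖² + M²√(∫‖W‖²)√(∫‖Θ(1−Θ)W‖²))`:
the symbol energy of the UNCUT function is controlled by that of the cut function plus the ENERGY (not the amplitude) of
the discarded piece, up to a commutator and an overlap term.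
[cite: Grafakos2014, Prop. 3.1.2 (5) and Prop. 3.2.7 (3)] -/
theorem tsum_symbol_sq_le_readmit {W Θ : UnitAddTorus d → ℂ} (hW : Continuous W)
    (hWs : Summable fun k => ‖mFourierCoeff W k‖) (hΘ : Continuous Θ)
    (hΘs : Summable fun k => ‖mFourierCoeff Θ k‖) (hΘ1' : ∀ x, ‖1 - Θ x‖ ≤ 1)
    {m : (d → ℤ) → ℝ} {M : ℝ} (hmM : ∀ k, |m k| ≤ M) {ω₂ : (d → ℤ) → ℝ} (hω0 : ∀ n, 0 ≤ ω₂ n)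
    (hω : ∀ k n, |m k ^ 2 - m (k - n) ^ 2| ≤ ω₂ n) (hωs : Summable fun n => ω₂ n * ‖mFourierCoeff Θ n‖) :
    ∑' k, m k ^ 2 * ‖mFourierCoeff W k‖ ^ 2 ≤
      (∑' k, m k ^ 2 * ‖mFourierCoeff (fun x => Θ x * W x) k‖ ^ 2) +
        M ^ 2 * (∫ x, ‖(1 - Θ x) * W x‖ ^ 2) +
        2 * ((∑' n, ω₂ n * ‖mFourierCoeff Θ n‖) * (∫ x, ‖W x‖ ^ 2) +
          M ^ 2 * Real.sqrt (∫ x, ‖W x‖ ^ 2) * Real.sqrt (∫ x, ‖Θ x * (1 - Θ x) * W x‖ ^ 2)) := by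
  have hM0 : 0 ≤ M := (abs_nonneg _).trans (hmM 0)
  set P : UnitAddTorus d → ℂ := fun x => Θ x * W x with hP_def
  set Q : UnitAddTorus d → ℂ := fun x => (1 - Θ x) * W x with hQ_def
  have hP : Continuous P := hΘ.mul hW
  have hQ : Continuous Q := (continuous_const.sub hΘ).mul hW
  -- the two pieces: `Xp` exact, `Xm = M‖Q‖`
  obtain ⟨_, hQle⟩ := tsum_symbol_sq_le_sq_mul_integral hQ hmM
  have hQ0 : 0 ≤ ∫ x, ‖Q x‖ ^ 2 := integral_nonneg fun x => by positivity
  have hXm : Real.sqrt (∑' k, m k ^ 2 * ‖mFourierCoeff Q k‖ ^ 2) ≤ M * Real.sqrt (∫ x, ‖Q x‖ ^ 2) := by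
    calc Real.sqrt (∑' k, m k ^ 2 * ‖mFourierCoeff Q k‖ ^ 2) ≤ Real.sqrt (M ^ 2 * ∫ x, ‖Q x‖ ^ 2) :=
          Real.sqrt_le_sqrt hQle
      _ = M * Real.sqrt (∫ x, ‖Q x‖ ^ 2) := by rw [Real.sqrt_mul (sq_nonneg _), Real.sqrt_sq hM0]
  -- the overlap cross term
  have hc := norm_tsum_symbol_sq_cross_le_of_overlap (Θ₁ := Θ) (Θ₂ := fun x => 1 - Θ x) hW hWs hΘ hΘs
    (continuous_const.sub hΘ) hΘ1' hmM hω0 hω hωs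
  have hadd := tsum_symbol_sq_add_le_of_bounds hP hQ hmM le_rfl hXm hc
  have hPQ : (fun x => P x + Q x) = W := by
    funext x; simp only [hP_def, hQ_def]; ring
  rw [hPQ] at hadd
  have hsq : (M * Real.sqrt (∫ x, ‖Q x‖ ^ 2)) ^ 2 = M ^ 2 * ∫ x, ‖Q x‖ ^ 2 := by
    rw [mul_pow, Real.sq_sqrt hQ0]
  have hsq' : (Real.sqrt (∑' k, m k ^ 2 * ‖mFourierCoeff P k‖ ^ 2)) ^ 2 = ∑' k, m k ^ 2 * ‖mFourierCoeff P k‖ ^ 2 :=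
    Real.sq_sqrt (tsum_nonneg fun k => by positivity)
  rw [hsq, hsq'] at hadd
  exact hadd

/-! ## §3 The overlap and the discarded piece are carried by the transition layer / the zone -/

/-- For a real cut-off `Θ ∈ [0,1]` and `‖W‖ ≤ B`: `∫‖Θ(1−Θ)W‖² ≤ (B/4)²·vol{x : Θ x ≠ 0 ∧ Θ x ≠ 1}` — the overlap
term lives on the transition layer of the cut-off. [folklore] -/
theorem integral_norm_sq_overlap_le {W : UnitAddTorus d → ℂ} (hW : Continuous W) {θ : UnitAddTorus d → ℝ}
    (hθ : Continuous θ) (hθ0 : ∀ x, 0 ≤ θ x) (hθ1 : ∀ x, θ x ≤ 1) {B : ℝ} (hB : ∀ x, ‖W x‖ ≤ B) :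
    ∫ x, ‖(θ x : ℂ) * (1 - θ x) * W x‖ ^ 2 ≤ (B / 4) ^ 2 * volume.real {x | θ x ≠ 0 ∧ θ x ≠ 1} := by
  have hB0 : 0 ≤ B := (norm_nonneg _).trans (hB 0)
  set T : Set (UnitAddTorus d) := {x | θ x ≠ 0 ∧ θ x ≠ 1} with hT_def
  have hTm : MeasurableSet T := by
    have h1 : MeasurableSet {x | θ x ≠ 0} := (isClosed_eq hθ continuous_const).measurableSet.compl
    have h2 : MeasurableSet {x | θ x ≠ 1} := (isClosed_eq hθ continuous_const).measurableSet.compl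
    exact h1.inter h2
  have hpt : ∀ x, ‖(θ x : ℂ) * (1 - θ x) * W x‖ ^ 2 ≤ T.indicator (fun _ => (B / 4) ^ 2) x := by
    intro x
    by_cases hx : x ∈ T
    · rw [Set.indicator_of_mem hx]
      have hθθ : θ x * (1 - θ x) ≤ 1 / 4 := by nlinarith [sq_nonneg (θ x - 1 / 2)]
      have hθθ0 : 0 ≤ θ x * (1 - θ x) := mul_nonneg (hθ0 x) (by linarith [hθ1 x])
      rw [norm_mul, norm_mul, Complex.norm_real, show ((1 : ℂ) - θ x) = ((1 - θ x : ℝ) : ℂ) by push_cast; ring,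
        Complex.norm_real, Real.norm_eq_abs, Real.norm_eq_abs, abs_of_nonneg (hθ0 x),
        abs_of_nonneg (by linarith [hθ1 x] : 0 ≤ 1 - θ x)]
      calc (θ x * (1 - θ x) * ‖W x‖) ^ 2 ≤ (1 / 4 * B) ^ 2 := by
            refine pow_le_pow_left₀ (mul_nonneg hθθ0 (norm_nonneg _)) ?_ 2
            exact mul_le_mul hθθ (hB x) (norm_nonneg _) (by norm_num)
        _ = (B / 4) ^ 2 := by ring
    · rw [Set.indicator_of_notMem hx]
      have h0 : θ x * (1 - θ x) = 0 := by
        simp only [hT_def, Set.mem_setOf_eq, not_and_or, not_not] at hx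
        rcases hx with h | h
        · rw [h, zero_mul]
        · rw [h, sub_self, mul_zero]
      have : (θ x : ℂ) * (1 - θ x) = 0 := by exact_mod_cast h0
      rw [this, zero_mul, norm_zero, zero_pow two_ne_zero]
  calc ∫ x, ‖(θ x : ℂ) * (1 - θ x) * W x‖ ^ 2 ≤ ∫ x, T.indicator (fun _ => (B / 4) ^ 2) x := by
        refine integral_mono ?_ ((integrable_const _).indicator hTm) hpt
        exact (((Complex.continuous_ofReal.comp hθ).mul
          (continuous_const.sub (Complex.continuous_ofReal.comp hθ))).mul hW).norm.pow 2 |>.integrable_unitAddTorus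
    _ = (B / 4) ^ 2 * volume.real T := by
        rw [integral_indicator hTm, setIntegral_const, smul_eq_mul, mul_comm]

/-- For a real cut-off `Θ` with `|1 − Θ| ≤ 1` and `‖W‖ ≤ B`: `∫‖(1−Θ)W‖² ≤ B²·vol{x : Θ x ≠ 1}` — the discarded piece is
carried by the zone (the set where the cut-off is not `1`), and enters the ledger with its ENERGY. [folklore] -/
theorem integral_norm_sq_one_sub_mul_le {W : UnitAddTorus d → ℂ} (hW : Continuous W) {θ : UnitAddTorus d → ℝ}
    (hθ : Continuous θ) (hθ1 : ∀ x, |1 - θ x| ≤ 1) {B : ℝ} (hB : ∀ x, ‖W x‖ ≤ B) :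
    ∫ x, ‖((1 : ℂ) - θ x) * W x‖ ^ 2 ≤ B ^ 2 * volume.real {x | θ x ≠ 1} := by
  have hB0 : 0 ≤ B := (norm_nonneg _).trans (hB 0)
  set Z : Set (UnitAddTorus d) := {x | θ x ≠ 1} with hZ_def
  have hZm : MeasurableSet Z := (isClosed_eq hθ continuous_const).measurableSet.compl
  have hpt : ∀ x, ‖((1 : ℂ) - θ x) * W x‖ ^ 2 ≤ Z.indicator (fun _ => B ^ 2) x := by
    intro x
    by_cases hx : x ∈ Z
    · rw [Set.indicator_of_mem hx, norm_mul, show ((1 : ℂ) - θ x) = ((1 - θ x : ℝ) : ℂ) by push_cast; ring,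
        Complex.norm_real, Real.norm_eq_abs, mul_pow]
      calc |1 - θ x| ^ 2 * ‖W x‖ ^ 2 ≤ 1 ^ 2 * B ^ 2 :=
            mul_le_mul (pow_le_pow_left₀ (abs_nonneg _) (hθ1 x) 2) (pow_le_pow_left₀ (norm_nonneg _) (hB x) 2)
              (sq_nonneg _) (by norm_num)
        _ = B ^ 2 := by ring
    · rw [Set.indicator_of_notMem hx]
      simp only [hZ_def, Set.mem_setOf_eq, not_not] at hx
      rw [show ((1 : ℂ) - θ x) = 0 by rw [hx]; simp, zero_mul, norm_zero, zero_pow two_ne_zero]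
  calc ∫ x, ‖((1 : ℂ) - θ x) * W x‖ ^ 2 ≤ ∫ x, Z.indicator (fun _ => B ^ 2) x := by
        refine integral_mono ?_ ((integrable_const _).indicator hZm) hpt
        exact ((continuous_const.sub (Complex.continuous_ofReal.comp hθ)).mul hW).norm.pow 2 |>.integrable_unitAddTorus
    _ = B ^ 2 * volume.real Z := by
        rw [integral_indicator hZm, setIntegral_const, smul_eq_mul, mul_comm]

/-! ## §4 Ledger arithmetic -/

/-- An amplitude increment `a ≥ 0` on a quantity `T ≤ B` costs at most `2Ba + a²` in energy:
`(T + a)² ≤ T² + (2Ba + a²)`. [folklore] -/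
theorem add_sq_le_sq_add {T a B : ℝ} (hTB : T ≤ B) (ha : 0 ≤ a) :
    (T + a) ^ 2 ≤ T ^ 2 + (2 * B * a + a ^ 2) := by
  nlinarith [mul_le_mul_of_nonneg_right hTB ha]

/-- Energy-ledger telescoping: if `V (s+1) ≤ V s + ε s` for all `s ≥ i₀` then `V n ≤ V i₀ + Σ_{s ∈ [i₀, n)} ε s`
for every `n ≥ i₀`. [folklore] -/
theorem ledger_le_add_sum {V ε : ℕ → ℝ} {i₀ : ℕ} (h : ∀ s, i₀ ≤ s → V (s + 1) ≤ V s + ε s) {n : ℕ} (hn : i₀ ≤ n) :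
    V n ≤ V i₀ + ∑ s ∈ Finset.Ico i₀ n, ε s := by
  induction n, hn using Nat.le_induction with
  | base => simp
  | succ n hn ih =>
      rw [Finset.sum_Ico_succ_top hn]
      linarith [h n hn]

/-- The same with a uniform per-step budget split into an amplitude part and an energy part: if `T s ≤ B`,
`0 ≤ a s` and `T (s+1)² ≤ (T s + a s)² + b s` for `s ≥ i₀`, then
`T n² ≤ T i₀² + Σ_{s ∈ [i₀,n)} (2B·a s + (a s)² + b s)`. [folklore] -/
theorem sq_ledger_le {T a b : ℕ → ℝ} {B : ℝ} {i₀ : ℕ} (hTB : ∀ s, T s ≤ B)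
    (ha : ∀ s, 0 ≤ a s) (h : ∀ s, i₀ ≤ s → T (s + 1) ^ 2 ≤ (T s + a s) ^ 2 + b s) {n : ℕ} (hn : i₀ ≤ n) :
    T n ^ 2 ≤ T i₀ ^ 2 + ∑ s ∈ Finset.Ico i₀ n, (2 * B * a s + a s ^ 2 + b s) := by
  refine ledger_le_add_sum (V := fun s => T s ^ 2) (fun s hs => ?_) hn
  have h1 := h s hs
  have h2 := add_sq_le_sq_add (hTB s) (ha s)
  linarith

end Summit.AnomalousDissipation.AnomalousDissipation.Theorems.SawtoothPulseCascade.K1Slot
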